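import Literature.NumberTheory.GaloisRepresentations.WeilDeligneSubquotient
import Literature.NumberTheory.GaloisRepresentations.PstWeilDeligneHeredity
import HarnessLib

/-!
# The clause "`WD ∘ D_pst` is exact (compatible with sub-objects and quotients)" for `p`-adic Hodge data
# — candidate clause (F16) of `IsFontaineDatum`

Topic `Literature/NumberTheory/GaloisRepresentations`; companion of the accepted candidate clause (F15)
`PstWeilDeligneData.TensorCompatible` (file `PstWeilDeligneTensorCompatible`: `WD(ρ ⊗ ρ') ≅ WD(ρ) ⊗ WD(ρ')`)
and of `Literature.NumberTheory.PAdicHodge.FontaineDpst` (the specification `IsFontaineDatum` of Fontaine's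
PINNED datum and its "Upgrade path").  This file does not import `FontaineDpst` (it is meant to be imported
BY it).

## Mathematics

Let `F/ℚ_ℓ` be finite and `0 → ρ₁ → ρ → ρ₂ → 0` a short exact sequence of continuous `ℓ`-adic representations
of `Γ_F` — in the tree's framed language: `ρ : Γ_F →ₜ* GL_{n₁+n₂}(ℚ̄_ℓ)` has the upper block form
`[[ρ₁, *], [0, ρ₂]]` (accepted `FramedRep.HasUpperBlockForm ρ ρ₁ ρ₂`).  (a) If `ρ` is de Rham so are `ρ₁`
and `ρ₂` — Fontaine, Exp. III Prop. 1.5.2 (sub-objects and quotients of `B`-admissible representations are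
`B`-admissible); IN THE TREE this is already a THEOREM for every datum (accepted
`PstWeilDeligneData.isDeRhamFramed_blocks`, file `PstWeilDeligneHeredity`), so it is not part of the clause.
(b) The functor `ρ ↦ WD(D_pst ρ)` on de Rham representations is EXACT: `D_pst` is exact on potentially
semistable representations (Fontaine, Exp. III Prop. 1.5.2 with Thm. 5.6.x / Exp. VIII §2.2; Brinon–Conrad
§9.1) and Fontaine's recipe `D ↦ WD(D)` (Exp. VIII §2.3.7; Deligne 1973 §8) is exact (it does not change the
underlying vector space functorially), so `WD(ρ₁)` is (isomorphic to) a sub-Weil–Deligne representation of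
`WD(ρ)` with quotient (isomorphic to) `WD(ρ₂)` — Deligne 1973 §8.4.1: Weil–Deligne representations form an
abelian category; tree `WeilDeligneRep.IsSubrep` / `ofSubrep` / `toQuotient`.  This is the interface lemma
through which local–global compatibility at `v ∣ ℓ` passes to Γ-stable DIRECT SUMMANDS (`* = 0`), e.g. the
Schur summands `ρ ⊗ ρ = Sym² ρ ⊕ ∧² ρ` of the exterior-square / spin / accidental-isogeny transports (with
(F15) for the tensor product itself), and to the graded pieces of reducible `ρ` (Eisenstein cases).

Degenerate checks: `n₁ = 0` or `n₂ = 0` (trivial); `* = 0` with `ρ₁ = ρ₂` unramified (consistent with (F8):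
PROVED below for the canonical triples); for Fontaine's datum and `ρ = ε ⊕ 1` the clause says `WD(ε)` embeds
in `WD(ε ⊕ 1)` with quotient `WD(1)`.

## Why a clause (and not a theorem about `fontainePst`)

As for (F15b): the accepted clauses (F1)–(F14) (and the candidate (F15)) see the Weil–Deligne half
`IsWeilDeligneOf` only on unramified representations ((F3), (F8)), on `ε` ((F4)), through crystallinity
((F5)–(F7), (F10), (F12)–(F14)) and through `⊗` ((F15)); none relates the Weil–Deligne representations
attached to `ρ`, to a Γ-stable sub-object `ρ₁` and to the quotient `ρ₂` when these are ramified of positive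
weight (a datum twisting the relation by a fixed unramified `χ ≠ 1` exactly on the IRREDUCIBLE ramified
inputs of dimension `≥ 2` meets the ACCEPTED clauses (F1)–(F14) whenever Fontaine's does — they see such
inputs only through crystallinity, which an unramified twist of `WD` preserves — and violates (F16) on
`ρ = σ ⊕ σ`, `σ` irreducible ramified de Rham of dimension `≥ 2`: `WD(ρ) = WD(σ) ⊕ WD(σ)` untwisted vs.
`WD(σ) ⊗ χ`; independence of (F16) from (F15) is not claimed).  The
cells of the decomposition cell `decomp-langlands` that move avatars through `∧²` / `Sym²` / spin
(`WallExteriorSquareWindowTransport` 26619, `SpinWindowTransport` 28329, `AccidentalWindowTransport` 28330,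
and the avatar-existence antecedent AVX of the `SeedReachSplit` node, critic rows 223/225) need exactly
(F15) ∧ (F16) at the places `v ∣ ℓ` (census instrument of record, CRITIC-LEDGER row 225: "∧²/Sym cells
additionally need the SUB-OBJECT compatibility of `IsWeilDeligneOf`").

## What this file provides (no `sorry`, no named fact, no instance)

* **the clause** `PstWeilDeligneData.SubquotientCompatible 𝔇` (a.k.a. (F16)) and its user-facing forms
  `SubquotientCompatible.exists_isSubrep` (with de Rham heredity folded in: the attached `r₁`, `r₂` EXIST)
  and the direct-summand reading in the docstrings;
* check `PstWeilDeligneData.subquotientCompatible_canonical_of_isLocallyUnramified`: **for every datum, on an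
  unramified upper-block `ρ` the conclusion of (F16) HOLDS for the canonical triples `(ρ|_{W_F}, 0)`,
  `(ρ₁|_{W_F}, 0)`, `(ρ₂|_{W_F}, 0)`** (accepted-to-be `FramedRep.HasUpperBlockForm.exists_isSubrep_ofRep_weilRestrict`
  of file `WeilDeligneSubquotient`) — i.e. (F16) is consistent with the Frobenius normalisation (F8) up to the
  (F8) isomorphisms (the transport of sub/quotient objects along those isomorphisms is routine and omitted);
* `FramedRep.IsLocallyUnramified.of_hasUpperBlockForm` — the blocks of an unramified upper-block `ρ` are
  unramified.

## References

* J.-M. Fontaine, *Représentations p-adiques semi-stables*, Astérisque 223 (1994), Exp. III, Prop. 1.5.2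
  and §5.6. [FontaineAsterisque223III]
* J.-M. Fontaine, *Représentations ℓ-adiques potentiellement semi-stables*, ibid., Exp. VIII, §2.2–§2.3.7.
  [FontaineAsterisque223VIII]
* O. Brinon, B. Conrad, *CMI Summer School notes on p-adic Hodge theory* (2009), §9.1. [BrinonConrad2009]
* P. Deligne, *Les constantes des équations fonctionnelles des fonctions L*, Antwerp II (1973), §8.4.1.
  [DeligneAntwerpII1973]
* J. Tate, *Number theoretic background*, Corvallis 1979, (4.1.5). [TateCorvallis1979]
-/

noncomputable section

open scoped MatrixGroups Matrix
open Field

namespace Literature.NumberTheory.GaloisRepresentations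

section Unramified

variable {F : Type} [Field F] [ValuativeRel F] [TopologicalSpace F] [IsNonarchimedeanLocalField F]
  {A : Type*} [CommRing A] [TopologicalSpace A] {n₁ n₂ : ℕ}

/-- **The blocks of an unramified upper-block representation are unramified** (`ρ(σ) = 1` forces
`ρ₁(σ) = 1`, `ρ₂(σ) = 1` by reading the diagonal blocks). [cite: TateCorvallis1979, (4.1.6)] -/
theorem FramedRep.IsLocallyUnramified.of_hasUpperBlockForm {ρ : FramedRep (absoluteGaloisGroup F) A (n₁ + n₂)}
    {ρ₁ : FramedRep (absoluteGaloisGroup F) A n₁} {ρ₂ : FramedRep (absoluteGaloisGroup F) A n₂}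
    (h : ρ.HasUpperBlockForm ρ₁ ρ₂) (hρ : ρ.IsLocallyUnramified) :
    ρ₁.IsLocallyUnramified ∧ ρ₂.IsLocallyUnramified := by
  refine ⟨fun σ hσ => Units.ext (Matrix.ext fun i j => ?_), fun σ hσ => Units.ext (Matrix.ext fun i j => ?_)⟩
  · rw [← (h σ).2.1 i j, hρ σ hσ, Units.val_one, Units.val_one]
    simp [Matrix.one_apply]
  · rw [← (h σ).2.2 i j, hρ σ hσ, Units.val_one, Units.val_one]
    simp [Matrix.one_apply]

end Unramified

/-! ### The clause -/

namespace PstWeilDeligneData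

variable {F : Type} [Field F] [ValuativeRel F] [TopologicalSpace F] [IsNonarchimedeanLocalField F]
  {ℓ : ℕ} [Fact ℓ.Prime]

/-- **Candidate clause (F16) of `IsFontaineDatum`: `WD ∘ D_pst` is compatible with sub-objects and
quotients.**  For every short exact sequence of framed representations in an adapted frame — `ρ` of rank
`n₁ + n₂` with upper block form `[[ρ₁, *], [0, ρ₂]]` (accepted `FramedRep.HasUpperBlockForm`) — and
Weil–Deligne representations `r`, `r₁`, `r₂` the datum attaches to `ρ`, `ρ₁`, `ρ₂` (`IsWeilDeligneOf`;
intended `≅ WD(D_pst ·)`): `r` has a sub-Weil–Deligne representation `p` (accepted `WeilDeligneRep.IsSubrep`: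
stable under `W_F` and `N`) with `r|_p ≅ r₁` and `r/p ≅ r₂` (accepted `ofSubrep`, `toQuotient`,
`IsEquivalent`).  For the genuine datum: exactness of `D_pst` (Fontaine, Exp. III Prop. 1.5.2, §5.6;
Exp. VIII §2.2) and of Fontaine's recipe `D ↦ WD(D)` (Exp. VIII §2.3.7; Deligne 1973 §8.4.1).  The de Rham
half of exactness is the accepted theorem `isDeRhamFramed_blocks` (every datum).
[cite: FontaineAsterisque223III, Prop. 1.5.2] [cite: FontaineAsterisque223VIII, §2.3.7]
[cite: DeligneAntwerpII1973, §8.4.1] -/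
def SubquotientCompatible (𝔇 : PstWeilDeligneData F ℓ) : Prop :=
  ∀ ⦃n₁ n₂ : ℕ⦄ (ρ : FramedRep (absoluteGaloisGroup F) (PadicAlgCl ℓ) (n₁ + n₂))
    (ρ₁ : FramedRep (absoluteGaloisGroup F) (PadicAlgCl ℓ) n₁)
    (ρ₂ : FramedRep (absoluteGaloisGroup F) (PadicAlgCl ℓ) n₂)
    (r : WeilDeligneRep F (PadicAlgCl ℓ) (Fin (n₁ + n₂) → PadicAlgCl ℓ))
    (r₁ : WeilDeligneRep F (PadicAlgCl ℓ) (Fin n₁ → PadicAlgCl ℓ))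
    (r₂ : WeilDeligneRep F (PadicAlgCl ℓ) (Fin n₂ → PadicAlgCl ℓ)),
    ρ.HasUpperBlockForm ρ₁ ρ₂ → 𝔇.IsWeilDeligneOf ρ r → 𝔇.IsWeilDeligneOf ρ₁ r₁ → 𝔇.IsWeilDeligneOf ρ₂ r₂ →
      ∃ (p : Submodule (PadicAlgCl ℓ) (Fin (n₁ + n₂) → PadicAlgCl ℓ)) (hp : r.IsSubrep p),
        (r.ofSubrep p hp).IsEquivalent r₁ ∧ (r.toQuotient p hp).IsEquivalent r₂

/-- **User-facing form of (F16)** (with the de Rham heredity of the tree folded in): for a de Rham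
upper-block `ρ` with attached `r`, the blocks `ρ₁`, `ρ₂` are de Rham, have attached Weil–Deligne
representations, and for ALL attached `r₁`, `r₂` the representation `r` is an extension of `r₂` by `r₁`
(a sub-object `≅ r₁` with quotient `≅ r₂`).  When `* = 0` (block DIAGONAL `ρ = ρ₁ ⊕ ρ₂`) apply it twice
(to `ρ` and to the conjugate frame swapping the blocks) to read both summands as sub-objects.
[cite: FontaineAsterisque223III, Prop. 1.5.2] [cite: DeligneAntwerpII1973, §8.4.1] -/
theorem SubquotientCompatible.exists_isSubrep {𝔇 : PstWeilDeligneData F ℓ} (h𝔇 : 𝔇.SubquotientCompatible)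
    {n₁ n₂ : ℕ} {ρ : FramedRep (absoluteGaloisGroup F) (PadicAlgCl ℓ) (n₁ + n₂)}
    {ρ₁ : FramedRep (absoluteGaloisGroup F) (PadicAlgCl ℓ) n₁}
    {ρ₂ : FramedRep (absoluteGaloisGroup F) (PadicAlgCl ℓ) n₂}
    {r : WeilDeligneRep F (PadicAlgCl ℓ) (Fin (n₁ + n₂) → PadicAlgCl ℓ)}
    (hblk : ρ.HasUpperBlockForm ρ₁ ρ₂) (hρ : 𝔇.IsDeRhamFramed ρ) (hr : 𝔇.IsWeilDeligneOf ρ r) :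
    𝔇.IsDeRhamFramed ρ₁ ∧ 𝔇.IsDeRhamFramed ρ₂ ∧
      (∃ r₁, 𝔇.IsWeilDeligneOf ρ₁ r₁) ∧ (∃ r₂, 𝔇.IsWeilDeligneOf ρ₂ r₂) ∧
      ∀ r₁ r₂, 𝔇.IsWeilDeligneOf ρ₁ r₁ → 𝔇.IsWeilDeligneOf ρ₂ r₂ →
        ∃ (p : Submodule (PadicAlgCl ℓ) (Fin (n₁ + n₂) → PadicAlgCl ℓ)) (hp : r.IsSubrep p),
          (r.ofSubrep p hp).IsEquivalent r₁ ∧ (r.toQuotient p hp).IsEquivalent r₂ := by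
  have hblocks : 𝔇.IsDeRhamFramed ρ₁ ∧ 𝔇.IsDeRhamFramed ρ₂ := by
    refine 𝔇.isDeRhamFramed_blocks finSumFinEquiv (T := ρ) (A := ρ₁) (D := ρ₂) (fun g => ?_) hρ
    refine ⟨Matrix.of fun i j => ((ρ g : GL (Fin (n₁ + n₂)) (PadicAlgCl ℓ)) : Matrix _ _ (PadicAlgCl ℓ))
      (Fin.castAdd n₂ i) (Fin.natAdd n₁ j), ?_⟩
    refine Matrix.ext fun k l => ?_
    rw [Matrix.reindex_apply, Matrix.submatrix_apply]
    obtain ⟨h0, h1, h2⟩ := hblk g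
    refine Fin.addCases (fun i => ?_) (fun i => ?_) k <;> refine Fin.addCases (fun j => ?_) (fun j => ?_) l
    · rw [show finSumFinEquiv.symm (Fin.castAdd n₂ i) = Sum.inl i from finSumFinEquiv_symm_apply_castAdd i,
        show finSumFinEquiv.symm (Fin.castAdd n₂ j) = Sum.inl j from finSumFinEquiv_symm_apply_castAdd j,
        Matrix.fromBlocks_apply₁₁, h1]
    · rw [show finSumFinEquiv.symm (Fin.castAdd n₂ i) = Sum.inl i from finSumFinEquiv_symm_apply_castAdd i,
        show finSumFinEquiv.symm (Fin.natAdd n₁ j) = Sum.inr j from finSumFinEquiv_symm_apply_natAdd j,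
        Matrix.fromBlocks_apply₁₂, Matrix.of_apply]
    · rw [show finSumFinEquiv.symm (Fin.natAdd n₁ i) = Sum.inr i from finSumFinEquiv_symm_apply_natAdd i,
        show finSumFinEquiv.symm (Fin.castAdd n₂ j) = Sum.inl j from finSumFinEquiv_symm_apply_castAdd j,
        Matrix.fromBlocks_apply₂₁, h0, Matrix.zero_apply]
    · rw [show finSumFinEquiv.symm (Fin.natAdd n₁ i) = Sum.inr i from finSumFinEquiv_symm_apply_natAdd i,
        show finSumFinEquiv.symm (Fin.natAdd n₁ j) = Sum.inr j from finSumFinEquiv_symm_apply_natAdd j,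
        Matrix.fromBlocks_apply₂₂, h2]
  exact ⟨hblocks.1, hblocks.2, hblocks.1.exists_isWeilDeligneOf, hblocks.2.exists_isWeilDeligneOf,
    fun r₁ r₂ hr₁ hr₂ => h𝔇 ρ ρ₁ ρ₂ r r₁ r₂ hblk hr hr₁ hr₂⟩

/-- **(F16) holds, for EVERY datum, on the canonical triples of an unramified upper-block `ρ`**:
`((ρ|_{W_F}, 0))` has the block kernel as sub-Weil–Deligne representation, `≅ (ρ₁|_{W_F}, 0)`, with quotient
`≅ (ρ₂|_{W_F}, 0)` — so on unramified inputs (F16) is what the Frobenius normalisation (F8) already says, up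
to the (F8) isomorphisms.  (Pure representation theory: the datum enters only through the typing.)
[cite: DeligneAntwerpII1973, §8.4.1] [cite: TateCorvallis1979, (4.1.5)] -/
theorem subquotientCompatible_canonical_of_isLocallyUnramified (_𝔇 : PstWeilDeligneData F ℓ) {n₁ n₂ : ℕ}
    {ρ : FramedRep (absoluteGaloisGroup F) (PadicAlgCl ℓ) (n₁ + n₂)}
    {ρ₁ : FramedRep (absoluteGaloisGroup F) (PadicAlgCl ℓ) n₁}
    {ρ₂ : FramedRep (absoluteGaloisGroup F) (PadicAlgCl ℓ) n₂}
    (hblk : ρ.HasUpperBlockForm ρ₁ ρ₂) (hρ : ρ.IsLocallyUnramified) :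
    let r := WeilDeligneRep.ofRep (ρ.weilRestrict F) hρ.isUnramifiedRep_weilRestrict.isContinuousRep
    let r₁ := WeilDeligneRep.ofRep (ρ₁.weilRestrict F)
      (FramedRep.IsLocallyUnramified.of_hasUpperBlockForm hblk hρ).1.isUnramifiedRep_weilRestrict.isContinuousRep
    let r₂ := WeilDeligneRep.ofRep (ρ₂.weilRestrict F)
      (FramedRep.IsLocallyUnramified.of_hasUpperBlockForm hblk hρ).2.isUnramifiedRep_weilRestrict.isContinuousRep
    ∃ (p : Submodule (PadicAlgCl ℓ) (Fin (n₁ + n₂) → PadicAlgCl ℓ)) (hp : r.IsSubrep p),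
      (r.ofSubrep p hp).IsEquivalent r₁ ∧ (r.toQuotient p hp).IsEquivalent r₂ :=
  hblk.exists_isSubrep_ofRep_weilRestrict _ _ _

end PstWeilDeligneData

end Literature.NumberTheory.GaloisRepresentations

end
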